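import Literature.NumberTheory.Automorphic.AdelicGroupDataCompactMeasure
import Literature.NumberTheory.Automorphic.AdelicGroupDataGLnProofs
import Literature.NumberTheory.Automorphic.AdelicGroupDataGLOneProofs
import Literature.NumberTheory.Automorphic.GLnAdelicLocallyCompact
import Literature.NumberTheory.Automorphic.AdelicSecondCountable
import HarnessLib

/-!
# The automorphic measure of `GL₁`: `exists_isAutomorphicMeasure_gl 1 K`

Sibling proof file (theorems only, no `sorry`, no named fact) of
`Literature.NumberTheory.Automorphic.AdelicGroupData`. It PROVES the case `n = 1` of the named fact
`AdelicGroupData.exists_isAutomorphicMeasure_gl n K` (Borel–Harish-Chandra finiteness: a finite,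
`GL_n(𝔸_K)`-invariant Radon measure of full support on `GL_n(𝔸_K) ⧸ (ℝ_{>0} · GL_n(K))`;
Borel (1963), Thm. 5.8 / §5):

* `AdelicGroupData.exists_isAutomorphicMeasure_gl_one : exists_isAutomorphicMeasure_gl 1 K`.

For `n = 1` the automorphic quotient `GL₁(𝔸_K) ⧸ (ℝ_{>0} · Kˣ) ≅ C_K¹` is compact
(`compactSpace_automorphicQuotient_gl_one_holds`, finiteness of the class number and Dirichlet's
unit theorem; Weil, BNT IV §4 Thm. 6), so the general construction
`AdelicGroupData.exists_isAutomorphicMeasure_of_compactSpace` (`AdelicGroupDataCompactMeasure`)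
applies with the central retraction `exists_centralRetraction_gl 1 K` (`θ(g) = z(|det g|^{1/[K:ℚ]})`,
Weil's splitting `k_𝔸ˣ = k_𝔸¹ × M`), the discreteness of `GL₁(K)` (`gl_isDiscreteRational_holds`),
local compactness / second countability / Hausdorffness of `GL₁(𝔸_K)`, and the triviality of the
modular function of the *commutative* group `GL₁(𝔸_K)¹`. The cases `n ≥ 2` (non-compact quotient,
reduction theory) are not treated here.

## References

* A. Borel, *Some finiteness properties of adele groups over number fields*, Publ. Math. IHÉS 16
  (1963), §5 [Borel1963].
* A. Weil, *Basic Number Theory* (1967), Ch. IV §4 Thm. 5–6 [WeilBNT1967].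
-/

noncomputable section

open NumberField IsDedekindDomain MeasureTheory Measure Topology
open scoped NNReal MatrixGroups

namespace Literature.NumberTheory.Automorphic

namespace AdelicGroupData

variable (K : Type) [Field K] [NumberField K]

/-- `GL₁(𝔸_K)` is commutative (it is `𝔸_Kˣ` written as `1 × 1` matrices). [folklore] -/
theorem gl_one_mul_comm (g h : GL (Fin 1) (AdeleRing (𝓞 K) K)) : g * h = h * g := by
  refine Units.ext ?_
  rw [Units.val_mul, Units.val_mul]
  ext i j
  rw [Subsingleton.elim i 0, Subsingleton.elim j 0]
  simp [Matrix.mul_apply, mul_comm]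

/-- **The automorphic measure of `GL₁`** (the case `n = 1` of the named fact
`exists_isAutomorphicMeasure_gl`): the compact automorphic quotient
`GL₁(𝔸_K) ⧸ (ℝ_{>0} · Kˣ) ≅ C_K¹` carries a finite, `GL₁(𝔸_K)`-invariant Borel measure which is
positive on non-empty open sets and inner regular (`IsAutomorphicMeasure`) — its Haar probability
measure. From `exists_isAutomorphicMeasure_of_compactSpace` with
`compactSpace_automorphicQuotient_gl_one_holds`, `exists_centralRetraction_gl 1 K`,
`gl_isDiscreteRational_holds 1 K` and the commutativity of `GL₁(𝔸_K)` (so the modular function of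
`GL₁(𝔸_K)¹` is trivial). Borel (1963), §5; Weil, BNT IV §4 Thm. 6 (compactness of `k_𝔸¹/kˣ`).
[cite: Borel1963, §5] -/
theorem exists_isAutomorphicMeasure_gl_one : exists_isAutomorphicMeasure_gl 1 K := by
  haveI : LocallyCompactSpace (gl 1 K).Adelic := locallyCompactSpace_gl_adelic_holds 1 K
  haveI : SecondCountableTopology (gl 1 K).Adelic := secondCountableTopology_gl_adelic 1 K
  haveI : T2Space (gl 1 K).Adelic := t2Space_gl 1 K
  haveI : CompactSpace (gl 1 K).automorphicQuotient := compactSpace_automorphicQuotient_gl_one_holds K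
  obtain ⟨θ, hθc, hθA, hθa, hθγ⟩ := exists_centralRetraction_gl 1 K
  have hker : IsClosed ((θ.ker : Subgroup (gl 1 K).Adelic) : Set (gl 1 K).Adelic) := by
    have : ((θ.ker : Subgroup (gl 1 K).Adelic) : Set (gl 1 K).Adelic) = θ ⁻¹' {1} := by
      ext g
      simp only [SetLike.mem_coe, MonoidHom.mem_ker, Set.mem_preimage, Set.mem_singleton_iff]
    rw [this]
    exact isClosed_singleton.preimage hθc
  haveI hlc : LocallyCompactSpace θ.ker := hker.isClosedEmbedding_subtypeVal.locallyCompactSpace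
  haveI : SecondCountableTopology θ.ker := TopologicalSpace.Subtype.secondCountableTopology _
  have hmod : ∀ γ (hγ : γ ∈ (gl 1 K).arithmeticSubgroup),
      modularCharacter (⟨γ, (MonoidHom.mem_ker).2 (hθγ γ hγ)⟩ : θ.ker) = 1 := by
    intro γ hγ
    refine modularCharacter_eq_one_of_mem_center ?_
    rw [Subgroup.mem_center_iff]
    intro g
    exact Subtype.ext (gl_one_mul_comm K _ _)
  exact exists_isAutomorphicMeasure_of_compactSpace (gl 1 K) (gl_isDiscreteRational_holds 1 K)
    θ hθc hθA hθa hθγ hlc hmod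

end AdelicGroupData

end Literature.NumberTheory.Automorphic
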